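import Summits.CriticalPhenomena.PercolationContinuityZ3.Theorems.PercNearOneGluingNoHeavyLowerTailGuardedLonelyRelay
import Summits.CriticalPhenomena.PercolationContinuityZ3.Theorems.PercNearOneGluingNoHeavyLowerTailGeneralTerminalSeparation
import HarnessLib

/-!
# `NoHeavyLowerTail` (stmt-CriticalPhenomena-4575) — the ROW LEMMAS of the certificate machine in literal form

Support file (depth prover nh-dp-blobmono gen 2; `--supports stmt-CriticalPhenomena-4575`).  No definitions, no named
facts, no sorries.

The degree-2/3 certificate searches of the CIL / one-cut line (this unit's `job_deg3`, gen-1's `job_lp*`, the engine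
seat's LPs) use a small number of VALID PRODUCT INEQUALITIES ("rows") between probabilities of connection events of a
few terminals.  Two of them are already single tree lemmas: `ts` = `Theorems.terminalSeparation_general` (KN Lemma 1(i))
and `bts` = `Theorems.blockTerminalSeparation`.  This file supplies the other two in exactly the literal form the
machine emits, so that a found certificate can be replayed mechanically (with `…PatternCells` for the cell sums):

* `negCorr_lits` (`nc`): Kozma–Nitzan Lemma 1(ii) / BHK 2006 Thm 1.5 with sets, for a vertex `x`, a finite `T`, a
  multi-target `O` and an increasing guard `Q = {t ~ u for all (t,u) ∈ L}` with first components in `T`: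
  `μ(D) μ(E ∩ D ∩ Q) ≤ μ(E ∩ D) μ(D ∩ Q)`, `E = {x ~ O}`, `D = {x ≁ T}`;
* `kn_chain` (`kn`): the CHAIN ROW `μ(E ∩ D ∩ Q⁺) μ(D ∩ Q') ≤ μ(D ∩ Q⁺) μ(E ∩ D ∩ Q')` obtained from `negCorr_lits` and
  `terminalSeparation_general` by multiplication and cancellation (`chain_cancel`, with the degenerate cases).
-/

noncomputable section

namespace Summit.CriticalPhenomena.PercolationContinuityZ3.Theorems

open scoped BigOperators Classical
open MeasureTheory Set
open Literature.Probability.LatticeModels (prodBernoulli)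
open Literature.Probability.Percolation

variable {n : ℕ}

namespace RowLemmas

/-- Pure arithmetic of the KN chain: from `pD·a ≤ pED·b` (negative correlation) and `pED·c ≤ pD·d`
(terminal separation) with `a ≤ pED`, `c ≤ pD` and everything nonnegative, `a·c ≤ b·d`. [folklore] -/
theorem chain_cancel {pD pED a b c d : ℝ} (hD : 0 ≤ pD) (hED : 0 ≤ pED) (ha : 0 ≤ a) (hb : 0 ≤ b)
    (hc : 0 ≤ c) (hd : 0 ≤ d) (h1 : pD * a ≤ pED * b) (h2 : pED * c ≤ pD * d) (haED : a ≤ pED) (hcD : c ≤ pD) :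
    a * c ≤ b * d := by
  by_cases hD0 : pD = 0
  · have hc0 : c = 0 := le_antisymm (hD0 ▸ hcD) hc
    rw [hc0, mul_zero]; exact mul_nonneg hb hd
  by_cases hED0 : pED = 0
  · have ha0 : a = 0 := le_antisymm (hED0 ▸ haED) ha
    rw [ha0, zero_mul]; exact mul_nonneg hb hd
  have hDpos : 0 < pD := lt_of_le_of_ne hD (Ne.symm hD0)
  have hEDpos : 0 < pED := lt_of_le_of_ne hED (Ne.symm hED0)
  have hmul : (pD * a) * (pED * c) ≤ (pED * b) * (pD * d) :=
    mul_le_mul h1 h2 (mul_nonneg hED hc) (le_trans (mul_nonneg hD ha) h1)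
  have : (pD * pED) * (a * c) ≤ (pD * pED) * (b * d) := by nlinarith
  exact le_of_mul_le_mul_left this (mul_pos hDpos hEDpos)

/-- The multi-target connection indicator `F_O(C) = ∏_{v ∈ O} F_v(C)` is increasing in the edge cluster. [folklore] -/
theorem monotone_prod_connIndicatorFn (x : Fin n) (O : Finset (Fin n)) :
    Monotone fun C : Set (Sym2 (Fin n)) => ∏ v ∈ O, connIndicatorFn x v C := by
  intro C C' hCC'
  refine Finset.prod_le_prod (fun v _ => ?_) (fun v _ => monotone_connIndicatorFn x v hCC')
  unfold connIndicatorFn; split_ifs <;> norm_num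

/-- At the open edge cluster of `x`, `F_O` is the indicator of `{x ~ v for all v ∈ O}`. [folklore] -/
theorem prod_connIndicatorFn_openEdgeCluster (x : Fin n) (O : Finset (Fin n)) (ω : BondConfig (Fin n)) :
    (∏ v ∈ O, connIndicatorFn x v (openEdgeCluster ω x)) =
      ({ω' : BondConfig (Fin n) | ∀ v ∈ O, ω' ∈ openConn x v}).indicator 1 ω := by
  simp only [connIndicatorFn_openEdgeCluster]
  by_cases h : ∀ v ∈ O, ω ∈ (openConn x v : Set (BondConfig (Fin n)))
  · rw [indicator_of_mem (show ω ∈ {ω' : BondConfig (Fin n) | ∀ v ∈ O, ω' ∈ openConn x v} from h),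
      Pi.one_apply]
    exact Finset.prod_eq_one fun v hv => by rw [indicator_of_mem (h v hv), Pi.one_apply]
  · rw [indicator_of_notMem (show ω ∉ {ω' : BondConfig (Fin n) | ∀ v ∈ O, ω' ∈ openConn x v} from h)]
    push Not at h
    obtain ⟨v, hv, hnot⟩ := h
    exact Finset.prod_eq_zero hv (by rw [indicator_of_notMem hnot])

/-- The literal-guard indicator `G_L(W) = 1{(t,u) joined inside W for all (t,u) ∈ L}` is increasing in `W`. [folklore] -/
theorem monotone_litsFn (L : Finset (Fin n × Fin n)) :
    Monotone fun W : Set (Sym2 (Fin n)) =>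
      (if ∀ l ∈ L, (SimpleGraph.fromEdgeSet W).Reachable l.1 l.2 then (1 : ℝ) else 0) := by
  intro W W' hWW'
  dsimp only
  by_cases h : ∀ l ∈ L, (SimpleGraph.fromEdgeSet W).Reachable l.1 l.2
  · rw [if_pos h, if_pos (fun l hl => (h l hl).mono (SimpleGraph.fromEdgeSet_mono hWW'))]
  · rw [if_neg h]; split_ifs <;> norm_num

/-- Evaluated at the union of the open edge clusters of `T`, `G_L` (with first components in `T`) is the indicator of
`{t ~ u for all (t,u) ∈ L}`. [folklore] -/
theorem litsFn_biUnion_openEdgeCluster (T : Finset (Fin n)) (L : Finset (Fin n × Fin n)) (hL : ∀ l ∈ L, l.1 ∈ T)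
    (ω : BondConfig (Fin n)) :
    (if ∀ l ∈ L, (SimpleGraph.fromEdgeSet (⋃ t ∈ (↑T : Set (Fin n)), openEdgeCluster ω t)).Reachable l.1 l.2
      then (1 : ℝ) else 0) =
      ({ω' : BondConfig (Fin n) | ∀ l ∈ L, ω' ∈ openConn l.1 l.2}).indicator 1 ω := by
  by_cases h : ∀ l ∈ L, ω ∈ (openConn l.1 l.2 : Set (BondConfig (Fin n)))
  · rw [indicator_of_mem (show ω ∈ {ω' : BondConfig (Fin n) | ∀ l ∈ L, ω' ∈ openConn l.1 l.2} from h),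
      Pi.one_apply, if_pos]
    intro l hl
    have hl' : (openGraph ω).Reachable l.1 l.2 := h l hl
    exact (GuardedLonelyRelay.reachable_fromEdgeSet_openEdgeCluster hl').mono
      (SimpleGraph.fromEdgeSet_mono (Set.subset_biUnion_of_mem (Finset.mem_coe.2 (hL l hl))))
  · rw [indicator_of_notMem (show ω ∉ {ω' : BondConfig (Fin n) | ∀ l ∈ L, ω' ∈ openConn l.1 l.2} from h), if_neg]
    intro h'
    apply h
    intro l hl
    have hsub : (⋃ t ∈ (↑T : Set (Fin n)), openEdgeCluster ω t) ⊆ ω :=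
      Set.iUnion₂_subset fun s _ => openEdgeCluster_subset ω s
    exact (h' l hl).mono (SimpleGraph.fromEdgeSet_mono hsub)

/-- **Row `nc` (KN Lemma 1(ii) with literal guards).**  For a vertex `x`, finite sets `T`, `O` and a finite set `L`
of pairs with first components in `T`: with `E = {x ~ v ∀ v ∈ O}`, `D = {x ≁ t ∀ t ∈ T}`, `Q = {t ~ u ∀ (t,u) ∈ L}`,
`μ(D) μ(E ∩ D ∩ Q) ≤ μ(E ∩ D) μ(D ∩ Q)`.
[cite: KozmaNitzan2024, Lemma 1(ii) (p. 5); VandenbergHaggstromKahn2005, Thm. 1.5 (sets)] -/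
theorem negCorr_lits (w : Sym2 (Fin n) → unitInterval) (x : Fin n) (T O : Finset (Fin n))
    (L : Finset (Fin n × Fin n)) (hL : ∀ l ∈ L, l.1 ∈ T) :
    (prodBernoulli w).real {ω | ∀ t ∈ T, ω ∉ openConn x t} *
        (prodBernoulli w).real ({ω | ∀ v ∈ O, ω ∈ openConn x v} ∩ {ω | ∀ t ∈ T, ω ∉ openConn x t} ∩
          {ω | ∀ l ∈ L, ω ∈ openConn l.1 l.2}) ≤
      (prodBernoulli w).real ({ω | ∀ v ∈ O, ω ∈ openConn x v} ∩ {ω | ∀ t ∈ T, ω ∉ openConn x t}) *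
        (prodBernoulli w).real ({ω | ∀ t ∈ T, ω ∉ openConn x t} ∩ {ω | ∀ l ∈ L, ω ∈ openConn l.1 l.2}) := by
  set E : Set (BondConfig (Fin n)) := {ω | ∀ v ∈ O, ω ∈ openConn x v} with hE
  set D : Set (BondConfig (Fin n)) := {ω | ∀ t ∈ T, ω ∉ openConn x t} with hD
  set Q : Set (BondConfig (Fin n)) := {ω | ∀ l ∈ L, ω ∈ openConn l.1 l.2} with hQ
  have key := BHK2006_twoSetConditionalAssociation.negCorrelation w ({x} : Set (Fin n)) (↑T : Set (Fin n))
    (fun C => ∏ v ∈ O, connIndicatorFn x v C)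
    (fun W => if ∀ l ∈ L, (SimpleGraph.fromEdgeSet W).Reachable l.1 l.2 then (1 : ℝ) else 0)
    (monotone_prod_connIndicatorFn x O) (monotone_litsFn L)
  have hDset : {ω : BondConfig (Fin n) | ∀ s ∈ ({x} : Set (Fin n)), ∀ t ∈ (↑T : Set (Fin n)),
      ¬ (openGraph ω).Reachable s t} = D := by
    ext ω; simp only [mem_setOf_eq, mem_singleton_iff, forall_eq, Finset.mem_coe, hD]; rfl
  have hF : ∀ ω : BondConfig (Fin n), (∏ v ∈ O, connIndicatorFn x v (⋃ s ∈ ({x} : Set (Fin n)), openEdgeCluster ω s))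
      = E.indicator 1 ω := fun ω => by
    rw [biUnion_singleton]; exact prod_connIndicatorFn_openEdgeCluster x O ω
  have hG : ∀ ω : BondConfig (Fin n),
      (if ∀ l ∈ L, (SimpleGraph.fromEdgeSet (⋃ t ∈ (↑T : Set (Fin n)), openEdgeCluster ω t)).Reachable l.1 l.2
        then (1 : ℝ) else 0) = Q.indicator 1 ω := fun ω => litsFn_biUnion_openEdgeCluster T L hL ω
  simp only [hDset, hF, hG] at key
  rw [TripodExchange.setIntegral_indicator_mul_indicator_eq, TripodExchange.setIntegral_indicator_one_eq,
    TripodExchange.setIntegral_indicator_one_eq] at key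
  have e1 : (E ∩ D ∩ Q : Set (BondConfig (Fin n))) = D ∩ (E ∩ Q) := by
    rw [inter_comm E D, inter_assoc]
  have e2 : (E ∩ D : Set (BondConfig (Fin n))) = D ∩ E := inter_comm E D
  rw [e1, e2]
  exact key

/-- **Row `kn` (the KN chain row).**  With `E, D` as in `negCorr_lits`, an increasing literal guard `Q⁺` (pairs `L⁺`,
first components in `T`) and a decreasing separation guard `Q' = {t ≁ u ∀ (t,u) ∈ P}` (first components in `T`):
`μ(E ∩ D ∩ Q⁺) μ(D ∩ Q') ≤ μ(D ∩ Q⁺) μ(E ∩ D ∩ Q')`.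
[cite: KozmaNitzan2024, Lemma 1 (p. 5) and Lemma 2 (p. 6)] -/
theorem kn_chain (w : Sym2 (Fin n) → unitInterval) (x : Fin n) (T O : Finset (Fin n))
    (Lp : Finset (Fin n × Fin n)) (hLp : ∀ l ∈ Lp, l.1 ∈ T)
    (P : Finset (Fin n × Fin n)) (hP : ∀ p ∈ P, p.1 ∈ T) :
    (prodBernoulli w).real ({ω | ∀ v ∈ O, ω ∈ openConn x v} ∩ {ω | ∀ t ∈ T, ω ∉ openConn x t} ∩
          {ω | ∀ l ∈ Lp, ω ∈ openConn l.1 l.2}) *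
        (prodBernoulli w).real ({ω | ∀ t ∈ T, ω ∉ openConn x t} ∩ {ω | ∀ p ∈ P, ω ∉ openConn p.1 p.2}) ≤
      (prodBernoulli w).real ({ω | ∀ t ∈ T, ω ∉ openConn x t} ∩ {ω | ∀ l ∈ Lp, ω ∈ openConn l.1 l.2}) *
        (prodBernoulli w).real ({ω | ∀ v ∈ O, ω ∈ openConn x v} ∩
          ({ω | ∀ t ∈ T, ω ∉ openConn x t} ∩ {ω | ∀ p ∈ P, ω ∉ openConn p.1 p.2})) := by
  set μ := prodBernoulli w with hμ
  have h1 := negCorr_lits w x T O Lp hLp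
  have h2 := terminalSeparation_general w T O x P hP
  refine chain_cancel measureReal_nonneg measureReal_nonneg measureReal_nonneg measureReal_nonneg
    measureReal_nonneg measureReal_nonneg h1 h2 (measureReal_mono fun ω hω => hω.1) (measureReal_mono fun ω hω => hω.1)

end RowLemmas

end Summit.CriticalPhenomena.PercolationContinuityZ3.Theorems

end
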